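import Summits.RiemannHypothesis.RiemannHypothesis.Theses.LiHeightLog
import Summits.RiemannHypothesis.RiemannHypothesis.Theorems.LiAsymptoticLiSmoothMainTerm
import Summits.RiemannHypothesis.RiemannHypothesis.Theorems.LiAsymptoticLiOscillatoryS
import Summits.RiemannHypothesis.RiemannHypothesis.Theorems.LiAsymptoticLiAsymptoticBudget
import Summits.RiemannHypothesis.RiemannHypothesis.Theorems.LiAsymptoticLiFarZeroTailCube
import Summits.RiemannHypothesis.RiemannHypothesis.Theorems.LiAsymptoticLiLowZerosTrivial
import Literature.NumberTheory.LFunctions.EquivalentsKeiperLiProofs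
import HarnessLib

/-!
# RiemannHypothesis / LiHeightLog — item `Assembly` (RH-FREE): the ALL-RANGE Li asymptotic law from the cosh box
# comparison and the cosh tail count

Route `RiemannHypothesis/LiHeightLog` (round 6, rung L-P(P1-log) «Li HEIGHT LAW, LOGARITHMIC RANGE», cell `pub/rh-li`,
dossier `theory/route/r6/README-R6.md`), item `Assembly` (stmt-RiemannHypothesis-19650):
`Assembly := LiBoxCosh → LiCoshTailCount → LiTheory.LiAsymptoticLawAllRange`, i.e. the two new estimates give, for RH
verified to `T ≥ 1000` and EVERY `n ≥ 900`,

  `|λ_n − (n/2) log n − C₁ n| ≤ 2 √n log n + liCoshDefect n T`.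

Proof (`liHeightLog_assembly_proof`) = route `LiAsymptotic`'s PROVED assembly (`liAsymptotic_assembly_proof`,
`LiAsymptoticAssembly.lean`) with ONE step exchanged: the far-pair error above the verified height is no longer K1's
two-sided `2.82 n² Σ m/γ⁴ + (n/2) Σ m/γ³ ≤ liErrFar n T` (the only place `n ≤ T²/4` entered) but the COSH DEFECT
`Σ_{T<γ≤T'} m·liCoshWeight n γ + (n/2) Σ_{T<γ≤T'} m/γ³ ≤ liCoshTail n T + (n/2) log T/(4πT²) = liCoshDefect n T`
(hypotheses `LiBoxCosh`, `LiCoshTailCount` and the tree's RH-free cubic tail `liFarZeroTailCube_bound`).  Everything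
else is the landed machinery of route `LiAsymptotic`, used as theorems: the window split at `√n`, the low count
`liLowZerosTrivial_bound`, the smooth main term `liSmoothMainTerm_proof` (K2), the plain `S`-term bound
`liOscillatoryS_proof` (K3, `n ≥ 900`), and the budget `liAsymptoticBudget_proof` (K4) instantiated at
`T₁ = max(1000, 2√n)` (where `n ≤ T₁²/4` holds by construction and `liErrFar n T₁ ≥ 0` is dropped), whence
`liErrLow n + liErrSmooth n + liErrOscPlain n ≤ 2 √n log n`; finally `λ_n = lim_{T'} Re Σ_{liZeroBox T'}`
(`keiperLiCoeff_eq_zero_sum_holds`) and `le_of_tendsto`.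

RH-FREE [rh-li-prover]: the hypothesis is a FINITE verified height; nothing here bears on the truth of RH.
-/

noncomputable section

-- D-0017: `Summit.<S>.<S>.…` is the designed namespace of a single-problem summit.
set_option linter.dupNamespace false

open Filter Set MeasureTheory
open scoped Topology

namespace Summit.RiemannHypothesis.RiemannHypothesis.Theorems.LiTheory

open Literature.NumberTheory.LFunctions Literature.NumberTheory.LFunctions.SchoenfeldBound
open Literature.NumberTheory.DiophantineGeometry

/-- Splitting a window sum at an intermediate height (local copy for the assembly). -/
private theorem sum_zerosBetween_split_assemblyLog {a b : ℝ} (ha : 0 ≤ a) (hab : a ≤ b) (g : ℂ → ℝ) :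
    ∑ ρ ∈ zerosBetween 0 b, g ρ = (∑ ρ ∈ zerosBetween 0 a, g ρ) + ∑ ρ ∈ zerosBetween a b, g ρ := by
  classical
  have hsub : zerosBetween 0 a ⊆ zerosBetween 0 b := by
    intro ρ hρ
    rw [mem_zerosBetween le_rfl] at hρ ⊢
    exact ⟨hρ.1, hρ.2.1, hρ.2.2.1, hρ.2.2.2.1, hρ.2.2.2.2.trans hab⟩
  have hsd : zerosBetween a b = zerosBetween 0 b \ zerosBetween 0 a := by
    ext ρ
    rw [Finset.mem_sdiff, mem_zerosBetween ha, mem_zerosBetween le_rfl, mem_zerosBetween le_rfl]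
    constructor
    · rintro ⟨h0, h1, h2, h3, h4⟩
      exact ⟨⟨h0, h1, h2, by linarith, h4⟩, fun h ↦ by linarith [h.2.2.2.2]⟩
    · rintro ⟨⟨h0, h1, h2, h3, h4⟩, hn⟩
      refine ⟨h0, h1, h2, ?_, h4⟩
      by_contra hle
      exact hn ⟨h0, h1, h2, h3, not_lt.1 hle⟩
  rw [hsd, ← Finset.sum_sdiff hsub, add_comm]

/-- `liErrFar n T ≥ 0` for `T ≥ 1` (both tails carry the factor `log T ≥ 0`). -/
theorem liErrFar_nonneg (n : ℕ) {T : ℝ} (hT : 1 ≤ T) : 0 ≤ liErrFar n T := by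
  unfold liErrFar
  have hlog : 0 ≤ Real.log T := Real.log_nonneg hT
  have hπ := Real.pi_pos
  have hT0 : 0 < T := by linarith
  positivity

/-- The K4 budget of route `LiAsymptotic` at `T₁ = max(1000, 2√n)` with the far error dropped:
`liErrLow n + liErrSmooth n + liErrOscPlain n ≤ 2 √n log n` for every `n ≥ 900`. -/
theorem liErr_noFar_budget {n : ℕ} (hn : 900 ≤ n) :
    liErrLow n + liErrSmooth n + liErrOscPlain n ≤ 2 * Real.sqrt n * Real.log n := by
  set T₁ : ℝ := max 1000 (2 * Real.sqrt n) with hT₁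
  have hT1000 : (1000 : ℝ) ≤ T₁ := le_max_left _ _
  have hn0 : (0 : ℝ) ≤ n := by positivity
  have hnc : (n : ℝ) ≤ 1 / 4 * T₁ ^ 2 := by
    have h2 : 2 * Real.sqrt n ≤ T₁ := le_max_right _ _
    have hs : Real.sqrt n ^ 2 = n := Real.sq_sqrt hn0
    have h0 : 0 ≤ 2 * Real.sqrt n := by positivity
    nlinarith [pow_le_pow_left₀ h0 h2 2]
  have hB := (liAsymptoticBudget_proof n T₁ hT1000 hnc).1 hn
  have hfar := liErrFar_nonneg n (le_trans (by norm_num) hT1000)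
  linarith

/-- **Item `Assembly` of route `LiHeightLog` — PROVED** (RH-FREE): `LiBoxCosh → LiCoshTailCount →
LiTheory.LiAsymptoticLawAllRange` (route `LiAsymptotic`'s assembly with the far-pair step replaced by the cosh defect). -/
theorem liHeightLog_assembly_proof : Summit.RiemannHypothesis.RiemannHypothesis.Theses.LiHeightLog.Assembly := by
  intro h1 h2 T hT hRH n hn900
  have h3 := liFarZeroTailCube_bound
  have h4 := liLowZerosTrivial_bound
  have h5 := liSmoothMainTerm_proof
  have h6 := liOscillatoryS_proof
  -- common data
  have hT4 : (4 : ℝ) ≤ T := by linarith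
  have hπ := Real.pi_pos
  have hn1 : 1 ≤ n := le_trans (by norm_num) hn900
  have hn100 : 100 ≤ n := le_trans (by norm_num) hn900
  have hnR : (900 : ℝ) ≤ n := by exact_mod_cast hn900
  have hsqrt30 : (30 : ℝ) ≤ Real.sqrt n := by
    rw [show (30 : ℝ) = Real.sqrt 900 by rw [show (900 : ℝ) = 30 ^ 2 by norm_num, Real.sqrt_sq (by norm_num)]]
    exact Real.sqrt_le_sqrt hnR
  have hsqrt0 : (0 : ℝ) ≤ Real.sqrt n := Real.sqrt_nonneg _
  have hsqrt_le : Real.sqrt n ≤ (n : ℝ) ^ 2 := by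
    have h1' : Real.sqrt n ≤ (n : ℝ) := by
      rw [Real.sqrt_le_left (by positivity)]
      nlinarith
    nlinarith
  have hbudget := liErr_noFar_budget hn900
  -- pointwise bound for every large T'
  have hpt : ∀ T' : ℝ, max T ((n : ℝ) ^ 2) ≤ T' →
      |(∑ᶠ ρ ∈ liZeroBox T', (riemannZetaZeroOrder ρ : ℂ) * (1 - (1 - 1 / ρ) ^ n)).re - liMainTerm n|
        ≤ 2 * Real.sqrt n * Real.log n + liCoshDefect n T := by
    intro T' hT'
    have hTT' : T ≤ T' := le_trans (le_max_left _ _) hT'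
    have hnT' : (n : ℝ) ^ 2 ≤ T' := le_trans (le_max_right _ _) hT'
    have haT' : Real.sqrt n ≤ T' := hsqrt_le.trans hnT'
    -- K1⁺ + N2 + cubic tail: the far error is the cosh defect
    have hbox := h1 n T T' hRH hT4 hTT'
    have htail := h2 n T T' hT hTT'
    have ht3 := h3 T T' hT hTT'
    have hfar : (∑ ρ ∈ zerosBetween T T', (riemannZetaZeroOrder ρ : ℝ) * liCoshWeight n ρ.im)
        + (n : ℝ) / 2 * (∑ ρ ∈ zerosBetween T T', (riemannZetaZeroOrder ρ : ℝ) / ρ.im ^ 3) ≤ liCoshDefect n T := by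
      unfold liCoshDefect
      have := mul_le_mul_of_nonneg_left ht3 (by positivity : (0 : ℝ) ≤ (n : ℝ) / 2)
      linarith
    -- split the window at √n
    have hsplit := sum_zerosBetween_split_assemblyLog hsqrt0 haT'
      (fun ρ ↦ (riemannZetaZeroOrder ρ : ℝ) * liWindowWeight n ρ.im)
    -- LOW, SMOOTH, S
    have hlow := h4 n (Real.sqrt n) hsqrt30
    have hlow' : |2 * (∑ ρ ∈ zerosBetween 0 (Real.sqrt n), (riemannZetaZeroOrder ρ : ℝ) * liWindowWeight n ρ.im)
        - 2 * liCountMain (Real.sqrt n)| ≤ liErrLow n := by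
      unfold liErrLow; exact hlow
    have hsm := h5 n T' hn100 hnT'
    have hSS := (h6 n T' hnT').1 hn900
    -- triangle
    set B := (∑ᶠ ρ ∈ liZeroBox T', (riemannZetaZeroOrder ρ : ℂ) * (1 - (1 - 1 / ρ) ^ n)).re
    set W0 := ∑ ρ ∈ zerosBetween 0 (Real.sqrt n), (riemannZetaZeroOrder ρ : ℝ) * liWindowWeight n ρ.im
    set W1 := ∑ ρ ∈ zerosBetween (Real.sqrt n) T', (riemannZetaZeroOrder ρ : ℝ) * liWindowWeight n ρ.im
    set I := 2 / Real.pi * (∫ t in Real.sqrt n..T', liWindowWeight n t * riemannSiegelThetaDeriv t)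
    set M := liMainTerm n
    set L := liCountMain (Real.sqrt n)
    have hW : ∑ ρ ∈ zerosBetween 0 T', (riemannZetaZeroOrder ρ : ℝ) * liWindowWeight n ρ.im = W0 + W1 := hsplit
    rw [hW] at hbox
    have e1 := abs_le.1 (le_trans hbox hfar)
    have e2 := abs_le.1 hlow'
    have e3 := abs_le.1 hSS
    have e4 := abs_le.1 hsm
    rw [abs_le]
    constructor <;> linarith
  -- pass to the limit T' → ∞
  have hlim := keiperLiCoeff_eq_zero_sum_holds n hn1
  have hre : Tendsto (fun T' : ℝ ↦
      (∑ᶠ ρ ∈ liZeroBox T', (riemannZetaZeroOrder ρ : ℂ) * (1 - (1 - 1 / ρ) ^ n)).re) atTop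
      (𝓝 (keiperLiCoeff n)) := by
    have := (Complex.continuous_re.tendsto _).comp hlim
    simpa [Function.comp_def] using this
  have habs : Tendsto (fun T' : ℝ ↦
      |(∑ᶠ ρ ∈ liZeroBox T', (riemannZetaZeroOrder ρ : ℂ) * (1 - (1 - 1 / ρ) ^ n)).re - liMainTerm n|) atTop
      (𝓝 |keiperLiCoeff n - liMainTerm n|) :=
    (continuous_abs.tendsto _).comp (hre.sub_const _)
  exact le_of_tendsto habs (Filter.eventually_atTop.2 ⟨max T ((n : ℝ) ^ 2), hpt⟩)

end Summit.RiemannHypothesis.RiemannHypothesis.Theorems.LiTheory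

end
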